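import Summits.SmoothPoincare4.SmoothPoincare4.Theorems.SullivanDualWitnessChargeDefs
import Literature.Geometry.Symplectic.AlmostComplexStructure

/-!
# Cap data for the line `Sketch` of crux `WitnessCharge` (stmt-SmoothPoincare4-7824): the
one-chart end cap `X = (Σ ∖ p) ∪ {‖t‖ < ρ} × ℂ_σ`, `(t, σ) = (1/z, w)`

Route-posited vocabulary (lead c8, skeleton v15). The pencil member `u` of intercept `b`
(`IsPencilMember J u b`: `z(u ξ) − ξ → 0`, `w(u ξ) → b` in the flat complex coordinates
`Ycoord = (z, w)` of the standard end) closes up, in the coordinates `(t, σ) = (z⁻¹, w)`, to an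
EMBEDDED sphere through the point `(0, b)` of the added line `E = {t = 0} ≅ ℂ_σ`; distinct
intercepts give distinct points of `E`, so in the capped manifold `X` the compactified members
have TRIVIAL normal bundle (they are the fibres `σ = const` of the ruling near `E`; for `Σ = S⁴`,
`X = F₁ ∖ (fibre) ≅ ℂ × ℂP¹`). This converts the constrained (`m = 1`, `[û]·[û] = 1`) local-family
problem of crux `PencilLocalFamily` (stmt-SmoothPoincare4-16772) into the UNCONSTRAINED `m = 0`
statement `Literature.Geometry.Symplectic.hls_localFoliation_embeddedSphere_trivialNormal`
(crux `LocalFoliationEmbeddedSpheres`, stmt-SmoothPoincare4-16778, of route SymplecticCap) plus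
`Literature.Geometry.Symplectic.adjunction_embedded_of_somewhereInjective_sphere`
(crux stmt-SmoothPoincare4-16775) for the normal witness.

This file only RECORDS the interface the stubs of skeleton v15 share:

* `CapData S p J ε'` — a smooth 4-manifold `X` (Hausdorff, second countable, charted on `ℝ⁴`)
  with an almost complex structure `JX`, an open smooth embedding `ι : Σ ∖ p → X` with
  `dι = id`, `JX ∘ ι = J`, whose complement is a smooth injective curve `capPt : ℂ → X` (the line
  `E`), and a "cap chart" `capInv : {q : ℂ × ℂ | ‖q.1‖ < ρ} → X`, `capInv (0, σ) = capPt σ`,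
  `capInv (t, σ) = ι x` with `Ycoord p x = (t⁻¹, σ)` for `t ≠ 0`, a diffeomorphism onto an open set
  (inverse `capCoord`) in which `JX` is multiplication by `i`. Its EXISTENCE (gluing
  `Literature.Topology.FourManifolds.SmoothGlueData` along `(z, w) ↦ (z⁻¹, w)`) is stub
  `stub_capModel` of the skeleton; nothing is asserted here.
* `CapData.sphereU D u lam`, `CapData.sphereV D u b lam` — the two charts
  `ζ ↦ ι (u (lam ζ))`, `w ↦ ι (u (lam / w))` (`w ≠ 0`), `0 ↦ capPt b` of the compactified member
  at scale `lam`;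
* `CapData.AdmissibleScale D u lam` — `lam ≥ 4` and, for `‖ξ‖ ≥ lam / 2`, `u ξ` lies in the punctured
  `ε'`-chart-ball with `‖z(u ξ)‖ > ρ⁻¹ + 1` and `‖z(u ξ) − ξ‖ ≤ 1` (so the `V`-disc `‖w‖ ≤ 2` maps
  into the cap chart).

Deliberately NOT here: the construction, and any claim about members or families (those are the
registered stubs `stub_capModel`, `stub_memberSphere`, `stub_sphereHomotopy`,
`stub_interceptChart`, `stub_leafFloc`, `stub_localFamilyUniv_of_parts` of `Lines/Sketch.lean`).
-/

noncomputable section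

-- the prescribed namespace `Summit.<P>.<Sub>.…` duplicates `SmoothPoincare4` (P = Sub)
set_option linter.dupNamespace false

open scoped Manifold ContDiff Topology
open Set Filter Literature.Geometry.Symplectic Literature.Topology.FourManifolds

namespace Summit.SmoothPoincare4.SmoothPoincare4.Theorems.WitnessCharge.PencilIncompleteness

/-- **Cap data** for `(Σ, p, J, ε')`: the one-chart end cap `X = (Σ ∖ p) ∪ {‖t‖ < ρ} × ℂ_σ` of the
standard end, glued along `(t, σ) = (z⁻¹, w)` (`(z, w) = Ycoord`), as an almost complex
4-manifold `(X, JX)` containing `Σ ∖ p` (embedding `ι`, `dι = id`, `JX ∘ ι = J`) and the added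
line `E = capPt(ℂ)`, with the cap chart `capInv`/`capCoord` in which `JX = i`. Only the interface;
existence is stub `stub_capModel` of the line `Sketch` (skeleton v15). -/
structure CapData (S : HomotopySphere 4) (p : S.carrier)
    (J : ∀ x : punctured p, TangentSpace (𝓡 4) x →L[ℝ] TangentSpace (𝓡 4) x) (ε' : ℝ) where
  /-- The capped manifold `X = (Σ ∖ p) ∪ {‖t‖ < ρ} × ℂ`. -/
  X : Type
  /-- Topology of `X`. -/
  [topologicalSpace : TopologicalSpace X]
  /-- `X` is Hausdorff. -/
  [t2Space : T2Space X]
  /-- `X` is second countable. -/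
  [secondCountableTopology : SecondCountableTopology X]
  /-- The atlas of `X`, modelled on `ℝ⁴`. -/
  [chartedSpace : ChartedSpace (EuclideanSpace ℝ (Fin 4)) X]
  /-- `X` is a smooth manifold. -/
  [isManifold : IsManifold (𝓡 4) ∞ X]
  /-- The almost complex structure of `X` (`= J` on `Σ ∖ p`, `= i` in the cap chart). -/
  JX : AlmostComplexStructure (𝓡 4) ∞ X
  /-- The inclusion of `Σ ∖ p`. -/
  ι : punctured p → X
  /-- A left inverse of `ι` (arbitrary off `range ι`). -/
  ιinv : X → punctured p
  /-- The added line `E`: `capPt σ` is the point `(t, σ) = (0, σ)`. -/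
  capPt : ℂ → X
  /-- The cap coordinates `(t, σ)` (arbitrary off the cap chart domain). -/
  capCoord : X → ℂ × ℂ
  /-- The inverse cap chart `(t, σ) ↦` point (meaningful for `‖t‖ < ρ`). -/
  capInv : ℂ × ℂ → X
  /-- The radius of the cap chart in `t = z⁻¹`. -/
  ρ : ℝ
  /-- `0 < ρ`. -/
  ρ_pos : 0 < ρ
  /-- `ι` is smooth. -/
  contMDiff_ι : ContMDiff (𝓡 4) (𝓡 4) ∞ ι
  /-- `ι` is an open embedding. -/
  isOpenEmbedding_ι : Topology.IsOpenEmbedding ι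
  /-- `dι = id` (the charts of `X` at points of `Σ ∖ p` are the charts of `Σ ∖ p`). -/
  hasMFDerivAt_ι : ∀ x : punctured p,
    HasMFDerivAt (𝓡 4) (𝓡 4) ι x (ContinuousLinearMap.id ℝ (EuclideanSpace ℝ (Fin 4)))
  /-- `ιinv ∘ ι = id`. -/
  ιinv_ι : ∀ x : punctured p, ιinv (ι x) = x
  /-- `ιinv` is smooth on `range ι`. -/
  contMDiffOn_ιinv : ContMDiffOn (𝓡 4) (𝓡 4) ∞ ιinv (range ι)
  /-- `dιinv = id` at points of `range ι`. -/
  hasMFDerivAt_ιinv : ∀ x : punctured p,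
    HasMFDerivAt (𝓡 4) (𝓡 4) ιinv (ι x) (ContinuousLinearMap.id ℝ (EuclideanSpace ℝ (Fin 4)))
  /-- `JX = J` on `Σ ∖ p`. -/
  JX_ι : ∀ (x : punctured p) (v : EuclideanSpace ℝ (Fin 4)), JX (ι x) v = J x v
  /-- `X = ι(Σ ∖ p) ∪ E`. -/
  range_ι_union_range_capPt : range ι ∪ range capPt = univ
  /-- `ι(Σ ∖ p) ∩ E = ∅`. -/
  ι_ne_capPt : ∀ (x : punctured p) (σ : ℂ), ι x ≠ capPt σ
  /-- `capPt` is injective. -/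
  capPt_injective : Function.Injective capPt
  /-- `capPt` is smooth. -/
  contMDiff_capPt : ContMDiff 𝓘(ℝ, ℂ) (𝓡 4) ∞ capPt
  /-- `capCoord ∘ capInv = id` on `{‖t‖ < ρ}`. -/
  capCoord_capInv : ∀ q : ℂ × ℂ, ‖q.1‖ < ρ → capCoord (capInv q) = q
  /-- `capInv (0, σ) = capPt σ`. -/
  capInv_zero : ∀ σ : ℂ, capInv (0, σ) = capPt σ
  /-- For `0 < ‖t‖ < ρ`, `capInv (t, σ)` is the point of the punctured `ε'`-chart-ball with flat
  coordinates `(z, w) = (t⁻¹, σ)`. -/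
  capInv_flat : ∀ q : ℂ × ℂ, ‖q.1‖ < ρ → q.1 ≠ 0 →
    ∃ x : punctured p, capInv q = ι x ∧ InPuncturedChartBall p ε' x ∧ Ycoord p x = (q.1⁻¹, q.2)
  /-- Conversely, a point of the punctured `ε'`-chart-ball with `‖z‖ > ρ⁻¹` is `capInv (z⁻¹, w)`. -/
  capInv_Ycoord : ∀ x : punctured p, InPuncturedChartBall p ε' x → ρ⁻¹ < ‖(Ycoord p x).1‖ →
    capInv (((Ycoord p x).1)⁻¹, (Ycoord p x).2) = ι x
  /-- `capInv` is smooth on `{‖t‖ < ρ}`. -/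
  contMDiffOn_capInv : ContMDiffOn 𝓘(ℝ, ℂ × ℂ) (𝓡 4) ∞ capInv {q : ℂ × ℂ | ‖q.1‖ < ρ}
  /-- The cap chart domain is open. -/
  isOpen_capDom : IsOpen (capInv '' {q : ℂ × ℂ | ‖q.1‖ < ρ})
  /-- `capCoord` is smooth on the cap chart domain. -/
  contMDiffOn_capCoord :
    ContMDiffOn (𝓡 4) 𝓘(ℝ, ℂ × ℂ) ∞ capCoord (capInv '' {q : ℂ × ℂ | ‖q.1‖ < ρ})
  /-- `capInv` is a local diffeomorphism: its differential is bijective … -/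
  mfderiv_capInv_bijective : ∀ q : ℂ × ℂ, ‖q.1‖ < ρ →
    Function.Bijective (mfderiv 𝓘(ℝ, ℂ × ℂ) (𝓡 4) capInv q)
  /-- … with inverse the differential of `capCoord`. -/
  mfderiv_capCoord_comp : ∀ q : ℂ × ℂ, ‖q.1‖ < ρ →
    (mfderiv (𝓡 4) 𝓘(ℝ, ℂ × ℂ) capCoord (capInv q)).comp (mfderiv 𝓘(ℝ, ℂ × ℂ) (𝓡 4) capInv q) =
      ContinuousLinearMap.id ℝ (ℂ × ℂ)
  /-- `JX` is multiplication by `i` in the cap chart. -/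
  JX_capInv : ∀ q : ℂ × ℂ, ‖q.1‖ < ρ → ∀ v : ℂ × ℂ,
    JX (capInv q) (mfderiv 𝓘(ℝ, ℂ × ℂ) (𝓡 4) capInv q v) =
      mfderiv 𝓘(ℝ, ℂ × ℂ) (𝓡 4) capInv q (Complex.I • v)

attribute [instance] CapData.topologicalSpace CapData.t2Space CapData.secondCountableTopology
  CapData.chartedSpace CapData.isManifold

namespace CapData

variable {S : HomotopySphere 4} {p : S.carrier}
  {J : ∀ x : punctured p, TangentSpace (𝓡 4) x →L[ℝ] TangentSpace (𝓡 4) x} {ε' : ℝ}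

/-- The `ζ`-chart of the compactified curve `u` at scale `lam`: `ζ ↦ ι (u (lam ζ))`. -/
def sphereU (D : CapData S p J ε') (u : ℂ → punctured p) (lam : ℝ) : ℂ → D.X :=
  fun ζ => D.ι (u ((lam : ℂ) * ζ))

/-- The `w = ζ⁻¹`-chart of the compactified curve `u` of intercept `b` at scale `lam`:
`w ↦ ι (u (lam / w))` for `w ≠ 0` and `0 ↦ capPt b` (the point at infinity of the member). -/
def sphereV (D : CapData S p J ε') (u : ℂ → punctured p) (b : ℂ) (lam : ℝ) : ℂ → D.X :=
  fun w => if w = 0 then D.capPt b else D.ι (u ((lam : ℂ) * w⁻¹))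

/-- **Admissible scale** for the compactification of `u`: `lam ≥ 4` and for `‖ξ‖ ≥ lam / 2` the point
`u ξ` lies in the punctured `ε'`-chart-ball with `‖z(u ξ)‖ > ρ⁻¹ + 1` and `‖z(u ξ) − ξ‖ ≤ 1`. -/
def AdmissibleScale (D : CapData S p J ε') (u : ℂ → punctured p) (lam : ℝ) : Prop :=
  4 ≤ lam ∧ ∀ ξ : ℂ, lam / 2 ≤ ‖ξ‖ →
    InPuncturedChartBall p ε' (u ξ) ∧ D.ρ⁻¹ + 1 < ‖(Ycoord p (u ξ)).1‖ ∧
      ‖(Ycoord p (u ξ)).1 - ξ‖ ≤ 1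

/-- Unfolding lemma for `sphereU` (definitional). -/
theorem sphereU_apply (D : CapData S p J ε') (u : ℂ → punctured p) (lam : ℝ) (ζ : ℂ) :
    D.sphereU u lam ζ = D.ι (u ((lam : ℂ) * ζ)) := rfl

/-- Unfolding lemma for `sphereV` at `w ≠ 0` (definitional up to the `if`). -/
theorem sphereV_apply_of_ne (D : CapData S p J ε') (u : ℂ → punctured p) (b : ℂ) (lam : ℝ)
    {w : ℂ} (hw : w ≠ 0) : D.sphereV u b lam w = D.ι (u ((lam : ℂ) * w⁻¹)) := if_neg hw

/-- Unfolding lemma for `sphereV` at `w = 0` (definitional up to the `if`). -/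
theorem sphereV_zero (D : CapData S p J ε') (u : ℂ → punctured p) (b : ℂ) (lam : ℝ) :
    D.sphereV u b lam 0 = D.capPt b := if_pos rfl

/-- Unfolding lemma for `AdmissibleScale` (definitional). -/
theorem admissibleScale_iff (D : CapData S p J ε') (u : ℂ → punctured p) (lam : ℝ) :
    D.AdmissibleScale u lam ↔ 4 ≤ lam ∧ ∀ ξ : ℂ, lam / 2 ≤ ‖ξ‖ →
      InPuncturedChartBall p ε' (u ξ) ∧ D.ρ⁻¹ + 1 < ‖(Ycoord p (u ξ)).1‖ ∧
        ‖(Ycoord p (u ξ)).1 - ξ‖ ≤ 1 := Iff.rfl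

end CapData

/-- At an admissible scale (`lam ≥ 4`) the points `‖ξ‖ ≥ lam / 2` of the parameter plane are
nonzero (used to pass between the two charts `sphereU`, `sphereV`). Registered helper of the crux. -/
theorem helper_admissibleScale_ne_zero :
    ∀ (lam : ℝ) (ξ : ℂ), 4 ≤ lam → lam / 2 ≤ ‖ξ‖ → ξ ≠ 0 := by
  intro lam ξ hlam hξ h
  rw [h, norm_zero] at hξ
  linarith


end Summit.SmoothPoincare4.SmoothPoincare4.Theorems.WitnessCharge.PencilIncompleteness
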